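import Summits.HodgeConjecture.HodgeConjecture.Theorems.Ring2HypothesesDescentAbsoluteVariational
import HarnessLib

/-!
# Ring 2 — hypotheses layer, descent axis: row b06 `AbsoluteHodgeImpliesAlgebraicAV` has ITS OWN CM pivot —
# granted Principle B alone, it is the CM case of itself plus the CM-local row b08 (no `HC_CM`, no Main Theorem 2.11)

HONEST FRAMING (page 1, verbatim the cell's standing line): **research route conditional on HC_CM; not a
corollary; Q11.4-sentence-2 already refuted in dim ≥ 3.** Nothing in this file proves a case of the Hodge
conjecture, nothing discharges the binder of record b06 `Ring2.Hypotheses.AbsoluteHodgeImpliesAlgebraicAV`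
("absolute Hodge classes on complex abelian varieties are algebraic", `Ring2HypothesesDescent` :73; OPEN, in the
dictionary `≡ HC_AV` modulo Deligne's Main Theorem 2.11 = the named fact c1
`deligne1982_hodgeClasses_abelianVariety_absoluteHodge`), and `HC_CM` — written BY NAME as
`Theses.RankFourFaces.CMAbelianHodge`, never restated — occurs in §4 only: as a HYPOTHESIS in (M6) (it implies the CM
case of row b06, fact-free), as a CONCLUSION modulo c1 in (M7)/(M7′), and as the intermediate station of (M8);
§§1–3 are `HC_CM`-free. No definition, no new named fact,
no `sorry`; every Literature input is a PRE-EXISTING named fact of the tree, taken as a hypothesis by name: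

* `Deligne1982.deligne1982_principleB` — Deligne 1982 Thm. 2.12 (Principle B) = Charles–Schnell Thm. 11.3.7, in the
  tree's typing WITH AN ABSOLUTE ANCHOR ("if `t_s` is an absolute Hodge cycle for one `s`, then for all `s`";
  table row c22 of `BINDER-OWNERS.md`);
* `HodgeTheory.deligne1982_cycleClass_absoluteHodge` — Example 2.1 (a) (c23; §3 only, through ring2-b06 g38's (K4));
* `Motives.catanese2002_abelianFibres_of_abelianFibre` — Catanese 2002 (c21; §3 only, through (K4));
* `Deligne1982.deligne1982_cmDenseMumfordTateFamilies` — Deligne 1982 Prop. 6.1 / Charles–Schnell Thm. 11.5.11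
  (c8; one corollary, through the deform seat's `Ring2.Deform.cmAnchoredFamilies_of_deligne1982`);
* `HodgeTheory.deligne1982_hodgeClasses_abelianVariety_absoluteHodge` — Main Theorem 2.11 (c1; §4 (M7)/(M8) only).

## What this file adds (cell `pub-hodge-ring2`, Hodge ladder stage 3, binder seat ring2-b06 gen 45, row b06)

The dictionary's CM PIVOT (`Ring2HypothesesCMPivot`: `HC_CM ∧ CMAnchoredFamilies ∧ LocalVHCAtCM ⟹ HC_AV`,
rows b07 / b08, `HC_CM` load-bearing) and its EXACTNESS (ring2-b02 g23, `Ring2BindersAbelianSchemeVHCCMGerm` §4: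
`HC_AV ↔ HC_CM ∧ LocalVHCAtCM` granted b07 and c21) say that on the pivot road `HC_AV` is PRECISELY its CM case
plus the CM-local transport row. Ring2-b06 g38's (K7) ran the pivot with row b06 as the TRANSPORT input
(`HC_CM ∧ b07 ∧ b06 ⟹ HC_AV`). This file runs Deligne's reduction to CM type (Introduction p. 6: "one shows
that it suffices to prove the main result for `A` an abelian variety of CM-type"; Prop. 6.1 + Thm. 2.12) for
the ALGEBRAICITY OF ABSOLUTE HODGE CLASSES, i.e. for ROW b06 ITSELF, with the CM case of row b06 as the anchor
input:

* the CM case of row b06, spelled as the LOCAL NOTATION `AbsoluteHodgeImpliesAlgebraicCM[]` — "absolute Hodge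
  classes on complex abelian varieties OF CM TYPE are algebraic", the CM hypothesis being symbol for symbol the
  one of `HC_CM` (`End⁰(A) ⊇` a commutative reduced `ℚ`-subalgebra of dimension `2 · dim A`). It is NOT `HC_CM`
  (its hypothesis on the class is absoluteness, Charles–Schnell Def. 11.2.3, not Hodge-ness) and NOT a new
  definition or named fact: it is the common weakening "row b06 ∩ `HC_CM`" (§4: `⟸ HC_CM` (M6) and `⟸` row b06
  (M6′) fact-free; `⟹ HC_CM` modulo c1 (M7)), kept a notation so that no statement is added to the dictionary (typer2's
  call whether to name it, as for `MumfordTateCMAnchorsSep`).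
* §1 (M1) `isAbsoluteHodgeClass_map_fiberι_of_absolute_anchor` — Principle B in GLOBAL-CLASS form with an
  ABSOLUTE anchor (the Literature proof file `PrincipleBAlgebraicAnchor` typed the algebraic anchor only): for a
  good family over an irreducible base and `W ∈ H²ᵖ(𝒳(ℂ); ℂ)`, if `W|_{𝒳_{s₀}}` is absolute Hodge then every
  `W|_{𝒳_s}` is. (M2) `isAbsoluteHodgeClass_map_of_fibreIncl_of_principleB` — the same between two fibres
  PRESENTED BY ABELIAN VARIETIES (`A.X ≅ 𝒳_t`, `B.X ≅ 𝒳_u`; `Theorems.stub_absoluteOfIso` moves absoluteness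
  across the charts): the per-instance engine of the CM-anchored families of row b07.
* §2 (M3) `absoluteHodgeImpliesAlgebraicAV_of_cm_of_cmAnchoredFamilies_of_localVHCAtCM_of_principleB` — **THE CM
  PIVOT OF ROW b06: `AbsoluteHodgeImpliesAlgebraicCM[] ∧ CMAnchoredFamilies ∧ LocalVHCAtCM ⟹
  AbsoluteHodgeImpliesAlgebraicAV` granted Principle B ALONE** — an absolute Hodge class `c` on `A` is `e^* G`
  in a CM-anchored family (row b07); Principle B carries ABSOLUTENESS FORWARD to the CM fibre `A₀` (M2); the CM
  case of row b06 makes `G|_{A₀}` ALGEBRAIC; row b08 and the Hilbert-scheme countability theorem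
  (`CMPivot.vhcAlongBase_of_localVHCAtCM`, over the tree's THEOREM `charlesSchnell_algebraicityLocus_iUnion_closed_holds`)
  carry ALGEBRAICITY BACK to `A`. No `HC_CM`, no Main Theorem 2.11, no Example 2.1 (a), no Catanese.
  (M3′) the same with row b07 supplied by c8. (M4) Hence, granted b07, b08 and Principle B, **row b06 IS its CM
  case**: `AbsoluteHodgeImpliesAlgebraicAV ↔ AbsoluteHodgeImpliesAlgebraicCM[]`.
* §3 (M5) EXACTNESS OF THE PIVOT ON THE ABSOLUTE AXIS — **`AbsoluteHodgeImpliesAlgebraicAV ↔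
  AbsoluteHodgeImpliesAlgebraicCM[] ∧ LocalVHCAtCM`** granted row b07 and {c21, c22, c23} (`⟹` is restriction
  and ring2-b06 g38's (K4) `b06 ⟹ b08`; `⟸` is (M3)): the twin, for row b06, of ring2-b02 g23's
  `Ring2.Binders.hc_av_iff_hc_cm_and_localVHCAtCM_of_cmAnchoredFamilies_of_catanese2002` (`HC_AV ↔ HC_CM ∧
  LocalVHCAtCM` granted b07 + c21). (M5′) with b07 from c8: every hypothesis a printed theorem.
* §4 the node against `HC_CM` and row b06: (M6) `HC_CM ⟹ AbsoluteHodgeImpliesAlgebraicCM[]` (fact-free; `HC_CM` a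
  HYPOTHESIS, by name); (M6′) row b06 `⟹` its CM case (fact-free); (M7) `AbsoluteHodgeImpliesAlgebraicCM[] ⟹ HC_CM`
  modulo c1 (`HC_CM` a CONCLUSION), (M7′) hence `HC_CM ↔` the node modulo c1 — the node is `≡ HC_CM` modulo c1
  exactly as row b06 is `≡ HC_AV` modulo c1 (`hc_av_iff_absoluteHodgeImpliesAlgebraicAV_of_deligne`): it is the
  CM SHADOW of row b06; (M8) the pivot road from the shadow to `HC_AV` costs exactly c1 (honest column (2) as a
  kernel statement).

So the four corners of the square {`HC_CM`, its absolute shadow} × {row b08, row b06} as third input of the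
pivot over row b07 read: `HC_CM ∧ b08 ⟹ HC_AV` (dictionary, fact-free) · `HC_CM ∧ b06 ⟹ HC_AV` ((K7), mod
{c22, c23}) · `shadow ∧ b08 ⟹ b06` ((M3), mod {c22}) · `shadow ∧ b06 ⟹ b06` (trivial).

## HONEST COLUMN (what the kernel theorems do NOT say)

(1) No node is discharged: `AbsoluteHodgeImpliesAlgebraicAV`, its CM case, `LocalVHCAtCM`, `CMAnchoredFamilies`
(CITE), `HC_AV`, `HC_CM` stay OPEN / CITE; the facts stay named facts; the BINDER-OWNERS numbers «10 · 0» do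
not move; the CM case of row b06 is a local notation, not a row (count rule). (2) MODULO c1 nothing here is
new: c1 makes the node `≡ HC_CM` and row b06 `≡ HC_AV`, and then (M3) is the dictionary's pivot. The content is
the MODULUS — (M3)/(M4) use Thm. 2.12 (Principle B) where the dictionary road `shadow ⟹[c1] HC_CM ⟹[pivot]
HC_AV ⟹ b06` uses Main Thm. 2.11 — and the typing of (M2): along row b07's families absoluteness is carried
to the CM fibre for free modulo print, so on the pivot road `HC_CM` may be weakened to its absolute shadow
when the target is row b06. (3) Not claimed: the node from the Weil-class rungs of the Weil-type ladder (an
absolute class on a CM abelian variety lies in the span of pullbacks of Weil classes only as a Hodge class —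
André 1992 — so nothing sharper than `HC_CM ⟸ R3` is available for it); anything over non-quasi-projective
bases (Principle B is typed on good families); a version with row b01 `MumfordTateCMAnchors` in place of b07
(its base is not quasi-projective as typed; ring2-b01's separated / curve forms would do — theirs, count once).
(4) (M7) concludes `HC_CM` only UNDER c1 and the open node — not evidence for `HC_CM`.

References (keys of `references.bib`): Deligne1982HodgeCycles (Introduction p. 6 and principle B; Def. 2.10;
Main Thm. 2.11; Thm. 2.12; Rem. 2.14; Prop. 6.1), CharlesSchnell2014Notes (Def. 11.2.3, Conj. 11.3.1, §11.3.2,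
Thm. 11.3.7, Prop. 11.3.11 (proof), Thm. 11.5.11), MumfordAV1970 (§19 Thm. 3 Cor., §22), Catanese2002DeformationTypes
(§4), BlochEsnaultKerz2014CharZero (appendix), SGA1 (Exp. XII Prop. 2.4).
-/

set_option linter.dupNamespace false

noncomputable section

open CategoryTheory AlgebraicGeometry
open Literature.AlgebraicGeometry Literature.AlgebraicGeometry.Motives
open Literature.AlgebraicGeometry.HodgeTheory Literature.AlgebraicGeometry.Deligne1982
open Summit.HodgeConjecture.HodgeConjecture.Theorems.HodgeAbelianVarieties.CMPivot (isCM_iff_exists_cmSubalgebra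
  vhcAlongBase_of_localVHCAtCM hodgeCM_of_cmAbelianHodge)

namespace Summit.HodgeConjecture.HodgeConjecture.Ring2.Hypotheses

/-- `AbsoluteHodgeImpliesAlgebraicCM[]` — **the CM case of row b06**: absolute Hodge classes (Charles–Schnell
Def. 11.2.3 = Deligne Def. 2.10 in de Rham form, `IsAbsoluteHodgeClass`) on complex abelian varieties OF CM TYPE
— `End⁰(A) = ℚ ⊗ End A` contains a commutative reduced `ℚ`-subalgebra of dimension `2 · dim A`, symbol for symbol
the CM hypothesis of `Theses.RankFourFaces.CMAbelianHodge` — are algebraic. NOT `HC_CM` (the class is assumed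
absolute, not merely Hodge); the common weakening of row b06 and `HC_CM`; OPEN. Local notation only (no statement
is added to the dictionary). -/
local notation3 (prettyPrint := false) "AbsoluteHodgeImpliesAlgebraicCM[]" =>
  ∀ (A : AbelianVariety ℂ),
    (∃ S : Subalgebra ℚ A.endAlgebra, IsReduced ↥S ∧ (∀ x ∈ S, ∀ y ∈ S, x * y = y * x) ∧
        Module.finrank ℚ ↥S = 2 * A.dim) →
      ∀ (p : ℕ) (c : complexBetti A.X (2 * p)), IsAbsoluteHodgeClass A.dim A.X p c → c ∈ algebraicClasses A.X p

/-! ## §1 Principle B with an ABSOLUTE anchor: global-class form, and between abelian-presented fibres -/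

/-- **(M1) Principle B, global-class form, absolute anchor.** For a good family `f : 𝒳 ⟶ S` of relative
dimension `n` (smooth projective over a smooth quasi-projective base) with `S` irreducible and a class
`W ∈ H²ᵖ(𝒳(ℂ); ℂ)` of the total space: if `W|_{𝒳_{s₀}}` is an absolute Hodge class for ONE `s₀ ∈ S(ℂ)`, then
`W|_{𝒳_s}` is an absolute Hodge class for EVERY `s ∈ S(ℂ)` — Deligne's Thm. 2.12 verbatim ("if `t_s` is an
absolute Hodge cycle for one `s`, then … for all `s`") applied to the flat section `s ↦ (s, W|_{𝒳_s})`
(`HodgeTheory.globalSection`, continuous in the étalé topology), `S(ℂ)` being connected (SGA1 XII 2.4,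
`preconnectedSpace_complexPoints_of_goodFamily`). The Literature proof file `PrincipleBAlgebraicAnchor` types the
ALGEBRAIC anchor (`…_of_mem_algebraicClasses`); this is the absolute one.
[cite: Deligne1982HodgeCycles, Thm. 2.12 and Rem. 2.14] [cite: CharlesSchnell2014Notes, Thm. 11.3.7] [cite: SGA1, Exp. XII Prop. 2.4] -/
theorem isAbsoluteHodgeClass_map_fiberι_of_absolute_anchor (hB : deligne1982_principleB)
    {n : ℕ} {𝒳 S : SchemeOver ℂ} {f : 𝒳 ⟶ S} (hf : GoodFamily n f) [IrreducibleSpace S.left]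
    {p : ℕ} (W : complexBetti 𝒳 (2 * p)) {s₀ : ComplexPoints S}
    (h₀ : IsAbsoluteHodgeClass n (fiberOver f s₀) p (complexBetti.map (fiberι f s₀) (2 * p) W))
    (s : ComplexPoints S) :
    IsAbsoluteHodgeClass n (fiberOver f s) p (complexBetti.map (fiberι f s) (2 * p) W) :=
  haveI := preconnectedSpace_complexPoints_of_goodFamily hf
  hB hf ‹_› p (globalSection f (2 * p) W) (continuous_globalSection f (2 * p) W) (fun _ => rfl) s₀ h₀ s

/-- **(M2) Absoluteness moves between abelian-presented fibres of a smooth projective family over a smooth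
irreducible quasi-projective base, granted Principle B.** For `f : 𝒳 ⟶ S` smooth projective of relative
dimension `dim A`, `S` quasi-projective, smooth and irreducible, a global class `G ∈ H²ᵖ(𝒳(ℂ); ℂ)`, a fibre
`𝒳_t` presented by the abelian variety `A` (`e = i ≫ ι_t`, `i : A.X ≅ 𝒳_t`) and a fibre `𝒳_u` presented by `B`
(`e_B = j ≫ ι_u`): if `e^* G` is absolute Hodge on `A`, then `e_B^* G` is absolute Hodge on `B`. Proof: across the
chart `i` (`Theorems.stub_absoluteOfIso`, fact-free), along the base by (M1), across the chart `j`;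
`dim B = dim A` (`Ring2.Binders.dim_eq_of_iso_fiberOver`). This is the per-instance engine of row b07's CM-anchored
families: NO Hodge condition along the family is used (it is a consequence, Rem. 2.14).
[cite: Deligne1982HodgeCycles, Thm. 2.12, Rem. 2.14 and Prop. 6.1] [cite: CharlesSchnell2014Notes, Def. 11.2.3 and Thm. 11.3.7] -/
theorem isAbsoluteHodgeClass_map_of_fibreIncl_of_principleB (hB : deligne1982_principleB)
    {A : AbelianVariety ℂ} {𝒳 S : SchemeOver ℂ} {f : 𝒳 ⟶ S} (hf : IsSmoothProjectiveFamily f A.dim)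
    (hS : IsQuasiProjectiveOver S) (hsm : Smooth S.hom) [IrreducibleSpace S.left]
    {p : ℕ} (G : complexBetti 𝒳 (2 * p)) {t : ComplexPoints S} {e : A.X ⟶ 𝒳}
    (he : ∃ i : A.X ≅ fiberOver f t, e = i.hom ≫ fiberι f t)
    (hc : IsAbsoluteHodgeClass A.dim A.X p (complexBetti.map e (2 * p) G))
    {B : AbelianVariety ℂ} {u : ComplexPoints S} {eB : B.X ⟶ 𝒳}
    (heB : ∃ j : B.X ≅ fiberOver f u, eB = j.hom ≫ fiberι f u) :
    IsAbsoluteHodgeClass B.dim B.X p (complexBetti.map eB (2 * p) G) := by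
  obtain ⟨i, rfl⟩ := he
  obtain ⟨j, rfl⟩ := heB
  -- across the chart `i : A.X ≅ 𝒳_t`
  have hi : complexBetti.map (i.hom ≫ fiberι f t) (2 * p) G =
      complexBetti.map i.hom (2 * p) (complexBetti.map (fiberι f t) (2 * p) G) := by
    rw [complexBetti.map_comp]
    rfl
  rw [hi] at hc
  have h₁ : IsAbsoluteHodgeClass A.dim (fiberOver f t) p (complexBetti.map (fiberι f t) (2 * p) G) := by
    have h := Theorems.stub_absoluteOfIso i.symm (AbelianVariety.isSmoothProjective_holds (A := A))
      (hf.isSmoothProjective t) p _ hc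
    rwa [Iso.symm_hom, i.complexBetti_map_inv_map_hom] at h
  -- along the base (Principle B, absolute anchor)
  have h₂ : IsAbsoluteHodgeClass A.dim (fiberOver f u) p (complexBetti.map (fiberι f u) (2 * p) G) :=
    isAbsoluteHodgeClass_map_fiberι_of_absolute_anchor hB ⟨hf, hS, hsm⟩ G h₁ u
  -- across the chart `j : B.X ≅ 𝒳_u`
  have h₃ : IsAbsoluteHodgeClass A.dim B.X p
      (complexBetti.map j.hom (2 * p) (complexBetti.map (fiberι f u) (2 * p) G)) :=
    Theorems.stub_absoluteOfIso j (hf.isSmoothProjective u) ((hf.isSmoothProjective u).of_iso j.symm) p _ h₂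
  have hj : complexBetti.map (j.hom ≫ fiberι f u) (2 * p) G =
      complexBetti.map j.hom (2 * p) (complexBetti.map (fiberι f u) (2 * p) G) := by
    rw [complexBetti.map_comp]
    rfl
  rw [hj, Ring2.Binders.dim_eq_of_iso_fiberOver hf j]
  exact h₃

/-! ## §2 The CM pivot of row b06: its CM case, the CM-anchored families and the CM-local row imply it -/

/-- **(M3) THE CM PIVOT OF ROW b06 — `AbsoluteHodgeImpliesAlgebraicCM[] ∧ CMAnchoredFamilies ∧ LocalVHCAtCM ⟹
AbsoluteHodgeImpliesAlgebraicAV`, granted Principle B alone (no `HC_CM`, no Main Theorem 2.11).** Deligne's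
reduction to CM type (Introduction p. 6, Prop. 6.1 + Thm. 2.12) run for the algebraicity of absolute classes: an
absolute Hodge class `c` on `A` is rational `(p,p)` (Def. 2.10), hence `c = e^* G` for a class `G` on a smooth
projective family over a smooth irreducible quasi-projective base through `A ≅ 𝒳_t` and a CM fibre `A₀ ≅ 𝒳_{s₀}`
(row b07 `CMAnchoredFamilies`, eigenvalue typing of CM; the two CM typings agree by the tree's unconditional
`CMPivot.isCM_iff_exists_cmSubalgebra`, Mumford §22); `e₀^* G` is ABSOLUTE on `A₀` by (M2); the CM case of row b06
makes it ALGEBRAIC; row b08 `LocalVHCAtCM` with the germ-to-global step (`CMPivot.vhcAlongBase_of_localVHCAtCM`: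
the algebraicity locus is a countable union of closed algebraic subsets — the tree's THEOREM
`charlesSchnell_algebraicityLocus_iUnion_closed_holds`, Charles–Schnell Prop. 11.3.11 (proof); `G` is Hodge along
the abelian fibres by b07) makes `e^* G = c` algebraic on `A`. Compare the dictionary's
`hc_av_of_hc_cm_of_cmAnchoredFamilies_of_localVHCAtCM` (`HC_CM` as anchor input, conclusion `HC_AV`, fact-free)
and ring2-b06 g38's (K7) (`HC_CM ∧ b07 ∧ b06 ⟹ HC_AV`): here the anchor input is `HC_CM`'s absolute shadow and
the conclusion is row b06. [cite: Deligne1982HodgeCycles, Introduction p. 6, Thm. 2.12 and Prop. 6.1]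
[cite: CharlesSchnell2014Notes, Thm. 11.3.7, Prop. 11.3.11 (proof) and Thm. 11.5.11] [cite: MumfordAV1970, §22] -/
theorem absoluteHodgeImpliesAlgebraicAV_of_cm_of_cmAnchoredFamilies_of_localVHCAtCM_of_principleB
    (hB : deligne1982_principleB) (hMT : CMAnchoredFamilies) (hV : LocalVHCAtCM)
    (hCM : AbsoluteHodgeImpliesAlgebraicCM[]) : AbsoluteHodgeImpliesAlgebraicAV := by
  intro A p c hc
  obtain ⟨S, 𝒳, f, G, t, s₀, e, A₀, e₀, h𝒳, hS, hsm, hirr, hf, hAt, hA₀, hA₀cm, hGc, hG⟩ :=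
    hMT A p c hc.isRationalClass hc.isOfHodgeType
  haveI := hirr
  -- absoluteness moves from `A ≅ 𝒳_t` to the CM fibre `A₀ ≅ 𝒳_{s₀}` (Principle B)
  have hc' : IsAbsoluteHodgeClass A.dim A.X p (complexBetti.map e (2 * p) G) := by rwa [hGc]
  have h₀ : IsAbsoluteHodgeClass A₀.dim A₀.X p (complexBetti.map e₀ (2 * p) G) :=
    isAbsoluteHodgeClass_map_of_fibreIncl_of_principleB hB hf hS hsm G hAt hc' hA₀
  -- the CM case of row b06 makes the CM fibre an ALGEBRAIC anchor
  have halg₀ : complexBetti.map e₀ (2 * p) G ∈ algebraicClasses A₀.X p :=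
    hCM A₀ ((isCM_iff_exists_cmSubalgebra A₀).1 hA₀cm) p _ h₀
  -- row b08 and the countability of the algebraicity locus carry algebraicity back to `A`
  have hA := vhcAlongBase_of_localVHCAtCM hV S 𝒳 f A.dim p G s₀ A₀ e₀ h𝒳 hS hsm hirr hf hA₀ hA₀cm halg₀ hG
    A e t hAt
  rwa [hGc] at hA

/-- **(M3′) The same with row b07 supplied by the printed fact c8** (Deligne 1982 Prop. 6.1 / Charles–Schnell
Thm. 11.5.11, CM-dense Mumford–Tate families; row b07 `⟸` c8 is the deform seat's
`Ring2.Deform.cmAnchoredFamilies_of_deligne1982`, count once): `AbsoluteHodgeImpliesAlgebraicCM[] ∧ LocalVHCAtCM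
⟹ AbsoluteHodgeImpliesAlgebraicAV` granted Principle B and c8. [cite: Deligne1982HodgeCycles, Prop. 6.1 and Thm. 2.12]
[cite: CharlesSchnell2014Notes, Thm. 11.5.11] -/
theorem absoluteHodgeImpliesAlgebraicAV_of_cm_of_deligne1982_of_localVHCAtCM_of_principleB
    (hB : deligne1982_principleB) (h₈ : deligne1982_cmDenseMumfordTateFamilies) (hV : LocalVHCAtCM)
    (hCM : AbsoluteHodgeImpliesAlgebraicCM[]) : AbsoluteHodgeImpliesAlgebraicAV :=
  absoluteHodgeImpliesAlgebraicAV_of_cm_of_cmAnchoredFamilies_of_localVHCAtCM_of_principleB hB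
    (Ring2.Deform.cmAnchoredFamilies_of_deligne1982 h₈) hV hCM

/-- **(M4) Granted rows b07, b08 and Principle B, ROW b06 IS ITS CM CASE: `AbsoluteHodgeImpliesAlgebraicAV ↔
AbsoluteHodgeImpliesAlgebraicCM[]`** (`⟹` restriction, fact-free; `⟸` (M3)). The transport rows reduce Deligne's
question on abelian varieties to CM abelian varieties, exactly as they reduce `HC_AV` to `HC_CM`
(`hc_av_of_hc_cm_of_cmAnchoredFamilies_of_localVHCAtCM`) — at the price of Principle B, which carries
absoluteness to the CM fibre. [cite: Deligne1982HodgeCycles, Introduction p. 6, Thm. 2.12 and Prop. 6.1]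
[cite: CharlesSchnell2014Notes, Thm. 11.3.7 and Thm. 11.5.11] -/
theorem absoluteHodgeImpliesAlgebraicAV_iff_cm_of_cmAnchoredFamilies_of_localVHCAtCM_of_principleB
    (hB : deligne1982_principleB) (hMT : CMAnchoredFamilies) (hV : LocalVHCAtCM) :
    AbsoluteHodgeImpliesAlgebraicAV ↔ AbsoluteHodgeImpliesAlgebraicCM[] :=
  ⟨fun h A _ p c hc => h A p c hc,
    absoluteHodgeImpliesAlgebraicAV_of_cm_of_cmAnchoredFamilies_of_localVHCAtCM_of_principleB hB hMT hV⟩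

/-! ## §3 Exactness of the pivot on the absolute axis: row b06 ↔ its CM case ∧ row b08 -/

/-- **(M5) EXACTNESS — `AbsoluteHodgeImpliesAlgebraicAV ↔ AbsoluteHodgeImpliesAlgebraicCM[] ∧ LocalVHCAtCM`,
granted row b07 `CMAnchoredFamilies`, Principle B (c22), Example 2.1 (a) (c23) and Catanese (c21).** `⟹`:
restriction to CM abelian varieties, and ring2-b06 g38's (K4)
`localVHCAtCM_of_absoluteHodgeImpliesAlgebraicAV_of_principleB_of_catanese` (row b06 ⟹ row b08, `U = S(ℂ)`);
`⟸`: (M3). So modulo print (b07, c21, c22, c23) row b08 is EXACTLY what the CM case of row b06 must be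
supplemented by on the pivot road — the twin, for row b06, of ring2-b02 g23's
`Ring2.Binders.hc_av_iff_hc_cm_and_localVHCAtCM_of_cmAnchoredFamilies_of_catanese2002` (`HC_AV ↔ HC_CM ∧
LocalVHCAtCM` granted b07 + c21), with Main Theorem 2.11 nowhere. [cite: Deligne1982HodgeCycles, Thm. 2.12, Example 2.1 (a) and Prop. 6.1]
[cite: CharlesSchnell2014Notes, Conj. 11.3.1, Thm. 11.3.7 and Prop. 11.3.11] [cite: Catanese2002DeformationTypes, §4 Thm. 4.1 and Thm. 4.6] -/
theorem absoluteHodgeImpliesAlgebraicAV_iff_cm_and_localVHCAtCM_of_cmAnchoredFamilies_of_principleB_of_catanese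
    (hMT : CMAnchoredFamilies) (hB : deligne1982_principleB) (hZ : deligne1982_cycleClass_absoluteHodge)
    (hC : catanese2002_abelianFibres_of_abelianFibre) :
    AbsoluteHodgeImpliesAlgebraicAV ↔ (AbsoluteHodgeImpliesAlgebraicCM[] ∧ LocalVHCAtCM) :=
  ⟨fun h => ⟨fun A _ p c hc => h A p c hc,
      localVHCAtCM_of_absoluteHodgeImpliesAlgebraicAV_of_principleB_of_catanese hB hZ hC h⟩,
    fun h => absoluteHodgeImpliesAlgebraicAV_of_cm_of_cmAnchoredFamilies_of_localVHCAtCM_of_principleB hB hMT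
      h.2 h.1⟩

/-- **(M5′) The same with row b07 supplied by c8** (count once: the deform seat's
`Ring2.Deform.cmAnchoredFamilies_of_deligne1982`): granted {c8, c21, c22, c23},
`AbsoluteHodgeImpliesAlgebraicAV ↔ AbsoluteHodgeImpliesAlgebraicCM[] ∧ LocalVHCAtCM` — every hypothesis a printed
theorem. [cite: Deligne1982HodgeCycles, Prop. 6.1, Thm. 2.12 and Example 2.1 (a)] [cite: CharlesSchnell2014Notes, Thm. 11.5.11]
[cite: Catanese2002DeformationTypes, §4] -/
theorem absoluteHodgeImpliesAlgebraicAV_iff_cm_and_localVHCAtCM_of_deligne1982_of_principleB_of_catanese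
    (h₈ : deligne1982_cmDenseMumfordTateFamilies) (hB : deligne1982_principleB)
    (hZ : deligne1982_cycleClass_absoluteHodge) (hC : catanese2002_abelianFibres_of_abelianFibre) :
    AbsoluteHodgeImpliesAlgebraicAV ↔ (AbsoluteHodgeImpliesAlgebraicCM[] ∧ LocalVHCAtCM) :=
  absoluteHodgeImpliesAlgebraicAV_iff_cm_and_localVHCAtCM_of_cmAnchoredFamilies_of_principleB_of_catanese
    (Ring2.Deform.cmAnchoredFamilies_of_deligne1982 h₈) hB hZ hC

/-! ## §4 The CM case of row b06 against `HC_CM` and against row b06: the CM shadow -/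

/-- **(M6) `HC_CM ⟹ AbsoluteHodgeImpliesAlgebraicCM[]` (fact-free).** `HC_CM` — BY NAME
`Theses.RankFourFaces.CMAbelianHodge`, a HYPOTHESIS here — gives the Hodge conjecture for every CM abelian variety
(smooth projectivity is the theorem `AbelianVariety.isSmoothProjective_holds`), and an absolute Hodge class is a
rational `(p,p)` class (Deligne, Introduction: "absolute Hodge ⟹ Hodge"). [cite: Deligne1982HodgeCycles, Introduction and Def. 2.10]
[cite: CharlesSchnell2014Notes, Def. 11.2.3] -/
theorem absoluteHodgeImpliesAlgebraicCM_of_hc_cm (hCM : Theses.RankFourFaces.CMAbelianHodge) :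
    AbsoluteHodgeImpliesAlgebraicCM[] :=
  fun A hA p c hc =>
    (hCM A (AbelianVariety.isSmoothProjective_holds (A := A)) hA).2 p c hc.isRationalClass hc.isOfHodgeType

/-- **(M6′) Row b06 `⟹` its CM case (restriction; fact-free).** [cite: Deligne1982HodgeCycles, Def. 2.10] -/
theorem absoluteHodgeImpliesAlgebraicCM_of_absoluteHodgeImpliesAlgebraicAV (h : AbsoluteHodgeImpliesAlgebraicAV) :
    AbsoluteHodgeImpliesAlgebraicCM[] :=
  fun A _ p c hc => h A p c hc

/-- **(M7) `AbsoluteHodgeImpliesAlgebraicCM[] ⟹ HC_CM` modulo Main Theorem 2.11 (c1).** On a CM abelian variety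
every rational `(p,p)` class is absolute (Deligne's theorem, the named fact
`deligne1982_hodgeClasses_abelianVariety_absoluteHodge`, a hypothesis in Lean), hence algebraic by the node; the
Hodge-model conjunct of `HodgeConjectureFor` is the theorem `nonempty_hodgeModel_holds`. `HC_CM` is a CONCLUSION
here (under c1 and the open node — not evidence for it). With (M6): the node is `≡ HC_CM` modulo c1, the CM
shadow of the dictionary cell "row b06 `≡ HC_AV` modulo c1" (`hc_av_iff_absoluteHodgeImpliesAlgebraicAV_of_deligne`).
[cite: Deligne1982HodgeCycles, Main Thm. 2.11] -/
theorem hc_cm_of_deligne_of_absoluteHodgeImpliesAlgebraicCM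
    (hD : deligne1982_hodgeClasses_abelianVariety_absoluteHodge) (h : AbsoluteHodgeImpliesAlgebraicCM[]) :
    Theses.RankFourFaces.CMAbelianHodge :=
  fun A hX hA => (hodgeConjectureFor_iff_of_isSmoothProjective nonempty_hodgeModel_holds hX).2
    fun p c hc hpp => h A hA p c (hD A p c hc hpp)

/-- **(M7′) Hence, modulo c1, `HC_CM ↔ AbsoluteHodgeImpliesAlgebraicCM[]`** ((M6) and (M7)).
[cite: Deligne1982HodgeCycles, Main Thm. 2.11] -/
theorem hc_cm_iff_absoluteHodgeImpliesAlgebraicCM_of_deligne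
    (hD : deligne1982_hodgeClasses_abelianVariety_absoluteHodge) :
    Theses.RankFourFaces.CMAbelianHodge ↔ AbsoluteHodgeImpliesAlgebraicCM[] :=
  ⟨absoluteHodgeImpliesAlgebraicCM_of_hc_cm, hc_cm_of_deligne_of_absoluteHodgeImpliesAlgebraicCM hD⟩

/-- **(M8) The pivot road from the CM shadow to `HC_AV` costs exactly c1**: `AbsoluteHodgeImpliesAlgebraicCM[] ∧
CMAnchoredFamilies ∧ LocalVHCAtCM ⟹ HC_AV` granted Main Theorem 2.11 — (M7) then the dictionary's pivot
`hc_av_of_hc_cm_of_cmAnchoredFamilies_of_localVHCAtCM` (equivalently (M3) then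
`hc_av_of_deligne_of_absoluteHodgeImpliesAlgebraicAV`; Principle B is not needed once c1 is granted). Recorded to
make honest-column (2) a kernel statement: modulo c1 this file's pivot is the dictionary's.
[cite: Deligne1982HodgeCycles, Main Thm. 2.11 and Prop. 6.1] -/
theorem hc_av_of_deligne_of_cm_of_cmAnchoredFamilies_of_localVHCAtCM
    (hD : deligne1982_hodgeClasses_abelianVariety_absoluteHodge) (hMT : CMAnchoredFamilies) (hV : LocalVHCAtCM)
    (hCM : AbsoluteHodgeImpliesAlgebraicCM[]) : Theses.PadicSemiregularLift.HodgeAbelianVarieties :=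
  hc_av_of_hc_cm_of_cmAnchoredFamilies_of_localVHCAtCM (hc_cm_of_deligne_of_absoluteHodgeImpliesAlgebraicCM hD hCM)
    hMT hV

/-! ## Audit: nothing is decided here

Every theorem has among its hypotheses the OPEN row `AbsoluteHodgeImpliesAlgebraicAV`, its OPEN CM case, the OPEN
row `LocalVHCAtCM`, the CITE row `CMAnchoredFamilies` and/or the OPEN binder `HC_CM` (`Theses.RankFourFaces.CMAbelianHodge`,
§4 only), next to printed theorems that are hypotheses in Lean by name — or concludes an equivalence between open
statements. Axiom closures: the three standard axioms. -/

#print axioms Summit.HodgeConjecture.HodgeConjecture.Ring2.Hypotheses.isAbsoluteHodgeClass_map_of_fibreIncl_of_principleB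
#print axioms Summit.HodgeConjecture.HodgeConjecture.Ring2.Hypotheses.absoluteHodgeImpliesAlgebraicAV_of_cm_of_cmAnchoredFamilies_of_localVHCAtCM_of_principleB
#print axioms Summit.HodgeConjecture.HodgeConjecture.Ring2.Hypotheses.absoluteHodgeImpliesAlgebraicAV_iff_cm_and_localVHCAtCM_of_cmAnchoredFamilies_of_principleB_of_catanese
#print axioms Summit.HodgeConjecture.HodgeConjecture.Ring2.Hypotheses.hc_cm_iff_absoluteHodgeImpliesAlgebraicCM_of_deligne

end Summit.HodgeConjecture.HodgeConjecture.Ring2.Hypotheses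

end
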